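import Summits.QuantumFields.YangMills.Theorems.UnitScaleTiltProp7FirstVariationCurrent
import HarnessLib

/-!
# Route `UnitScaleTilt`, crux K1 child «MinimiserStabilityRegPr» (stmt-QuantumFields-19200) — «blend-ℓ²» line (OWNER RULING g24-№1 §B), stub S4
# `firstVariationFibre`, step (i) of the refined plan: **THE FIRST VARIATION OF `Y = W′U* − 1` AND OF ITS LOGARITHM `X = log(1 + Y) ∈ 𝔰𝔲(2)` DIFFER BY
# `4ε₀·L^{−3(K−n)}·Σ‖Y‖²**, and `X` IS AN HONEST 𝔰𝔲(2) DIRECTION (skew-adjoint, traceless) whose exponential family `t ↦ e^{tX}U` JOINS `U` TO `W′`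

Cell `ym3-torus` ∕ width seat `ym-ust-19200-w1` (gen 0; HUMAN RULING D-0037 — YM₃ on T³ is ladder rung R3, not the Clay problem).  WHY.  Refined S4 plan (HOME
STATUS PROGRESS 5): run the Euler–Lagrange/fibre-lift argument of `Prop7FirstVariationFibreCurve.abs_lin_le_tree_of_su2` along `X_b := log(W′_bU_b*)` instead of
the skew part of `Y` — `X` is EXACTLY 𝔰𝔲(2)-valued ([Balaban1985Averaging] (23), tree `ExpMeanLog.star_mlog_eq_neg` ∕ `trace_mlog_eq_zero`) and `e^{X_b}U_b = W′_b`,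
so the exponential family joins the two configurations of the fibre (the defect of its `k`-fold averages vanishes at `t = 0` AND `t = 1`, turning the
second-order remainder into a two-point bound — steps (iii)–(iv)).  This file supplies step (i): the price of replacing `Y` by `X` in `Lin_U`.

WHAT IS PROVED (sorry-free, no definition).  `norm_sub_mlog_one_add_le` (`‖Y − log(1+Y)‖ ≤ 4‖Y‖²` for `‖Y‖ ≤ ½`, tree `B7Prop1Explicit.norm_mlog_sub_le`),
`mlog_one_add_su2` (for `1 + Y ∈ SU(2)` with `‖Y‖ ≤ ⅓`: `log(1+Y)` is skew-adjoint and traceless), `exp_mlog_one_add_mul` (`e^{log(1+Y)}U = (1+Y)U`, `‖Y‖ < 1`),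
**`abs_lin_sub_lin_log_le_T3`** (`|Lin_U(Y) − Lin_U(X)| ≤ 4ε₀(L^{K−n})⁻³Σ_b‖Y_b‖²`, `X_b = log(1 + Y_b)`, under `DivSmall`).

HONEST SCOPE.  Elementary; steps (iii) corrector velocity and (iv) defect velocity of the refined plan are NOT here.  Count-neutral helper toward
stmt-QuantumFields-19200 (`--supports`); nothing continuum ∕ OS ∕ mass-gap ∕ Clay.

References: T. Bałaban, CMP **98** (1985) 17–51 [Balaban1985Averaging] ((21), (23), (26) pp.21–22); CMP **99** (1985) 389–434 [Balaban1985BackgroundPropagators]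
((3.11) p.392); CMP **102** (1985) 277–309 [Balaban1985Variational] ((2), (6) p.278, (141)–(143) p.299).
-/

noncomputable section

open scoped BigOperators Matrix.Norms.L2Operator Matrix
open NormedSpace

namespace Summit.QuantumFields.YangMills.Theorems.Prop7FirstVariationLog

open Literature.MathematicalPhysics.QuantumFieldTheory.Balaban1983to89
open MatrixLog (mlog exp_mlog)
open B7Prop1Explicit (expRem expRem_mono expRem_le_sq norm_mlog_sub_le)
open B10Eq27TorusAxialLog (unitsField toUField)
open B10Eq68TorusRegularity (covDivT)
open Summit.QuantumFields.YangMills.Theorems.Prop7CovariantCoercivity (abs_re_trace_le)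
open Summit.QuantumFields.YangMills.Theorems.Prop7FirstVariationCurrent (lin_eq_neg_half_sum_re_trace_mul_covDivT)

/-! ## §1 The logarithm of `1 + Y` -/

section Algebra

variable {N : ℕ}

/-- **`‖Y − log(1 + Y)‖ ≤ 4‖Y‖²` for `‖Y‖ ≤ ½`** (series logarithm; [Balaban1985Averaging] (26)). [cite: Balaban1985Averaging, (21), (26) pp.21–22] -/
theorem norm_sub_mlog_one_add_le (Y : Matrix (Fin N) (Fin N) ℂ) (hY : ‖Y‖ ≤ 1 / 2) : ‖Y - mlog (1 + Y)‖ ≤ 4 * ‖Y‖ ^ 2 := by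
  have h1 : ‖(1 + Y) - 1‖ ≤ 1 / 2 := by rwa [add_sub_cancel_left]
  have h := norm_mlog_sub_le h1
  rw [add_sub_cancel_left] at h
  rw [norm_sub_rev]
  refine h.trans ?_
  calc expRem (2 * ‖Y‖) ≤ (2 * ‖Y‖) ^ 2 := expRem_le_sq (by positivity) (by linarith)
    _ = 4 * ‖Y‖ ^ 2 := by ring

/-- **`log(1 + Y)` IS AN 𝔰𝔲(2) DIRECTION** when `1 + Y ∈ SU(2)` and `‖Y‖ ≤ ⅓`: skew-adjoint (`ExpMeanLog.star_mlog_eq_neg`) and traceless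
(`ExpMeanLog.trace_mlog_eq_zero`, `2‖Y‖ < π`). [cite: Balaban1985Averaging, (23) p.21] -/
theorem mlog_one_add_su2 (Y : Matrix (Fin 2) (Fin 2) ℂ) (hW : 1 + Y ∈ Matrix.specialUnitaryGroup (Fin 2) ℂ) (hY : ‖Y‖ ≤ 1 / 3) :
    mlog (1 + Y) ∈ skewAdjoint (Matrix (Fin 2) (Fin 2) ℂ) ∧ (mlog (1 + Y)).trace = 0 := by
  have h1 : ‖(1 + Y) - 1‖ ≤ 1 / 3 := by rwa [add_sub_cancel_left]
  refine ⟨?_, ExpMeanLog.trace_mlog_eq_zero hW h1 ?_⟩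
  · exact ExpMeanLog.star_mlog_eq_neg (Matrix.mem_specialUnitaryGroup_iff.1 hW).1 h1
  · rw [Fintype.card_fin, add_sub_cancel_left]
    have := Real.pi_gt_three
    push_cast
    nlinarith [norm_nonneg Y]

/-- `e^{log(1+Y)}·U = (1 + Y)·U` (`‖Y‖ < 1`): the exponential family `t ↦ e^{t log(W′U*)}U` reaches `W′ = (1 + Y)U` at `t = 1`.
[cite: Balaban1985Averaging, (21) p.21] -/
theorem exp_mlog_one_add_mul (Y U : Matrix (Fin N) (Fin N) ℂ) (hY : ‖Y‖ < 1) : exp (mlog (1 + Y)) * U = (1 + Y) * U := by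
  have h1 : ‖(1 + Y) - 1‖ < 1 := by rwa [add_sub_cancel_left]
  rw [exp_mlog h1]

end Algebra

/-! ## §2 At the d = 3 carrier: `Lin_U(Y)` against `Lin_U(log(1 + Y))` -/

section Carrier

open T3ContinuumYM3Torus T3PrintedRegularMinimiser

/-- **S4(i): `|Lin_U(Y) − Lin_U(X)| ≤ 4ε₀·(L^{K−n})⁻³·Σ_b‖Y_b‖²` FOR `X_b = log(1 + Y_b)`**, `U` with the divergence clause `DivSmall F n K ε₀ U` of
print's regular space, `‖Y_b‖ ≤ ½` at every bond: both first variations in the displayed plaquette form of the schema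
`Prop7BlendClause1.atMostOneCriticalOrbit_of_reprSchema_T3` (iii); by the current identity the difference is the pairing of `J` with `Y − log(1+Y)`, and
`‖Y − log(1+Y)‖ ≤ 4‖Y‖²`, `‖J_b‖ < ε₀L^{−3(K−n)}`. [cite: Balaban1985BackgroundPropagators, (3.11) p.392; Balaban1985Averaging, (21), (26) pp.21–22] -/
theorem abs_lin_sub_lin_log_le_T3 (F : T3Family) (n K : ℕ) {ε₀ : ℝ} (U : GaugeField (F.P K) 0 (Matrix.specialUnitaryGroup (Fin 2) ℂ))
    (hU : DivSmall F n K ε₀ U) (Y A : PBond (F.P K) 0 → Matrix (Fin 2) (Fin 2) ℂ)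
    (hY : ∀ b : PBond (F.P K) 0, ‖Y b‖ ≤ 1 / 2) (hA : ∀ b : PBond (F.P K) 0, A b = mlog (1 + Y b)) :
    |(∑ p : Plaq (F.P K) 0, (1 / 2) * ((((((GaugeField.plaqHol U p : Matrix.specialUnitaryGroup (Fin 2) ℂ) : Matrix (Fin 2) (Fin 2) ℂ)) - 1)ᴴ
          * ((Y ⟨p.src, p.μ⟩
              + (U ⟨p.src, p.μ⟩ : Matrix (Fin 2) (Fin 2) ℂ) * Y ⟨p.src.shift p.μ, p.ν⟩ * star (U ⟨p.src, p.μ⟩ : Matrix (Fin 2) (Fin 2) ℂ)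
              - ((U ⟨p.src, p.μ⟩ * U ⟨p.src.shift p.μ, p.ν⟩ * (U ⟨p.src.shift p.ν, p.μ⟩)⁻¹ : Matrix.specialUnitaryGroup (Fin 2) ℂ) : Matrix (Fin 2) (Fin 2) ℂ)
                  * Y ⟨p.src.shift p.ν, p.μ⟩
                  * star ((U ⟨p.src, p.μ⟩ * U ⟨p.src.shift p.μ, p.ν⟩ * (U ⟨p.src.shift p.ν, p.μ⟩)⁻¹ : Matrix.specialUnitaryGroup (Fin 2) ℂ) : Matrix (Fin 2) (Fin 2) ℂ)
              - ((GaugeField.plaqHol U p : Matrix.specialUnitaryGroup (Fin 2) ℂ) : Matrix (Fin 2) (Fin 2) ℂ) * Y ⟨p.src, p.ν⟩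
                  * star ((GaugeField.plaqHol U p : Matrix.specialUnitaryGroup (Fin 2) ℂ) : Matrix (Fin 2) (Fin 2) ℂ))
            * ((GaugeField.plaqHol U p : Matrix.specialUnitaryGroup (Fin 2) ℂ) : Matrix (Fin 2) (Fin 2) ℂ))).trace).re)
      - (∑ p : Plaq (F.P K) 0, (1 / 2) * ((((((GaugeField.plaqHol U p : Matrix.specialUnitaryGroup (Fin 2) ℂ) : Matrix (Fin 2) (Fin 2) ℂ)) - 1)ᴴ
          * ((A ⟨p.src, p.μ⟩
              + (U ⟨p.src, p.μ⟩ : Matrix (Fin 2) (Fin 2) ℂ) * A ⟨p.src.shift p.μ, p.ν⟩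
                  * star (U ⟨p.src, p.μ⟩ : Matrix (Fin 2) (Fin 2) ℂ)
              - ((U ⟨p.src, p.μ⟩ * U ⟨p.src.shift p.μ, p.ν⟩ * (U ⟨p.src.shift p.ν, p.μ⟩)⁻¹ : Matrix.specialUnitaryGroup (Fin 2) ℂ) : Matrix (Fin 2) (Fin 2) ℂ)
                  * A ⟨p.src.shift p.ν, p.μ⟩
                  * star ((U ⟨p.src, p.μ⟩ * U ⟨p.src.shift p.μ, p.ν⟩ * (U ⟨p.src.shift p.ν, p.μ⟩)⁻¹ : Matrix.specialUnitaryGroup (Fin 2) ℂ) : Matrix (Fin 2) (Fin 2) ℂ)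
              - ((GaugeField.plaqHol U p : Matrix.specialUnitaryGroup (Fin 2) ℂ) : Matrix (Fin 2) (Fin 2) ℂ)
                  * A ⟨p.src, p.ν⟩
                  * star ((GaugeField.plaqHol U p : Matrix.specialUnitaryGroup (Fin 2) ℂ) : Matrix (Fin 2) (Fin 2) ℂ))
            * ((GaugeField.plaqHol U p : Matrix.specialUnitaryGroup (Fin 2) ℂ) : Matrix (Fin 2) (Fin 2) ℂ))).trace).re)|
      ≤ 4 * ε₀ * (((F.L : ℝ) ^ (K - n)) ^ 3)⁻¹ * ∑ b : PBond (F.P K) 0, ‖Y b‖ ^ 2 := by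
  rw [lin_eq_neg_half_sum_re_trace_mul_covDivT, lin_eq_neg_half_sum_re_trace_mul_covDivT, ← mul_sub, ← Finset.sum_sub_distrib]
  -- the difference pairs `J` with the Hermitian part `Y − A = ½(Y + Y*)`
  have hsub : ∀ b : PBond (F.P K) 0,
      ((Y b * covDivT 1 (unitsField (toUField U)) b.dir b.src).trace).re
        - ((A b * covDivT 1 (unitsField (toUField U)) b.dir b.src).trace).re
        = (((Y b - mlog (1 + Y b)) * covDivT 1 (unitsField (toUField U)) b.dir b.src).trace).re := by
    intro b
    rw [hA b, Matrix.sub_mul, Matrix.trace_sub, Complex.sub_re]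
  simp only [hsub]
  have hpow : ((F.L : ℝ)⁻¹) ^ (3 * (K - n)) = (((F.L : ℝ) ^ (K - n)) ^ 3)⁻¹ := by rw [inv_pow, mul_comm, pow_mul]
  -- bondwise: `|Re Tr(HJ)| ≤ 2‖H‖‖J‖ ≤ 2·½‖Y‖²·ε₀L^{−3k}`
  have hb : ∀ b : PBond (F.P K) 0,
      |(((Y b - mlog (1 + Y b)) * covDivT 1 (unitsField (toUField U)) b.dir b.src).trace).re|
        ≤ 2 * (4 * ‖Y b‖ ^ 2) * (ε₀ * (((F.L : ℝ) ^ (K - n)) ^ 3)⁻¹) := by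
    intro b
    have h1 := abs_re_trace_le ((Y b - mlog (1 + Y b)) * covDivT 1 (unitsField (toUField U)) b.dir b.src)
    have hJ : ‖covDivT 1 (unitsField (toUField U)) b.dir b.src‖ ≤ ε₀ * (((F.L : ℝ) ^ (K - n)) ^ 3)⁻¹ := by rw [← hpow]; exact (hU b).le
    have hH := norm_sub_mlog_one_add_le (Y b) (hY b)
    calc |(((Y b - mlog (1 + Y b)) * covDivT 1 (unitsField (toUField U)) b.dir b.src).trace).re|
        ≤ 2 * ‖(Y b - mlog (1 + Y b)) * covDivT 1 (unitsField (toUField U)) b.dir b.src‖ := by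
          simpa using h1
      _ ≤ 2 * ((4 * ‖Y b‖ ^ 2) * (ε₀ * (((F.L : ℝ) ^ (K - n)) ^ 3)⁻¹)) :=
          mul_le_mul_of_nonneg_left ((norm_mul_le _ _).trans (mul_le_mul hH hJ (norm_nonneg _) (by positivity))) (by norm_num)
      _ = 2 * (4 * ‖Y b‖ ^ 2) * (ε₀ * (((F.L : ℝ) ^ (K - n)) ^ 3)⁻¹) := by ring
  rw [abs_mul, abs_neg, abs_of_pos (by norm_num : (0 : ℝ) < 1 / 2)]
  calc (1 / 2) * |∑ b : PBond (F.P K) 0, (((Y b - mlog (1 + Y b)) * covDivT 1 (unitsField (toUField U)) b.dir b.src).trace).re|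
      ≤ (1 / 2) * ∑ b : PBond (F.P K) 0, 2 * (4 * ‖Y b‖ ^ 2) * (ε₀ * (((F.L : ℝ) ^ (K - n)) ^ 3)⁻¹) :=
        mul_le_mul_of_nonneg_left ((Finset.abs_sum_le_sum_abs _ _).trans (Finset.sum_le_sum fun b _ => hb b)) (by norm_num)
    _ = 4 * ε₀ * (((F.L : ℝ) ^ (K - n)) ^ 3)⁻¹ * ∑ b : PBond (F.P K) 0, ‖Y b‖ ^ 2 := by
        have e : ∀ b : PBond (F.P K) 0, 2 * (4 * ‖Y b‖ ^ 2) * (ε₀ * (((F.L : ℝ) ^ (K - n)) ^ 3)⁻¹) =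
            ‖Y b‖ ^ 2 * (8 * (ε₀ * (((F.L : ℝ) ^ (K - n)) ^ 3)⁻¹)) := fun b => by ring
        simp only [e]
        rw [← Finset.sum_mul]; ring

end Carrier

end Summit.QuantumFields.YangMills.Theorems.Prop7FirstVariationLog

end
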